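import Literature.NumberTheory.EllipticCurves.HeckeOnManinSymbols
import Literature.NumberTheory.Automorphic.PopaZagierHeckeElementPropertyA
import Literature.NumberTheory.EllipticCurves.PAdicLFunctionDistributionProofs
import HarnessLib

/-!
# Route `KolyvaginDepthDoor`, crux `KolyvaginDepthSupplyKN` (stmt-BirchSwinnertonDyer-22820) —
# DEPTH TABLE v27, KIT 1/3: M-symbols of `Γ₀(N)`, `N` prime, INDEXED BY `ℙ¹(ℤ/N) = {0, …, N}`, and their
# linear relations (two-term, three-term, conjugation, Popa–Zagier Hecke) in index form

Helper file of the lead prover of line `levelone` (kdd-p1 g31; `--supports stmt-BirchSwinnertonDyer-22820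
--as helper`); it closes nothing and BSD is NOT proved by it.

PURPOSE OF THE KIT (files `…MSymbolCertCosets`, `…MSymbolCertUnique`, `…MSymbolCertPeriods`). Every row of the
depth table (v17–v26) is conditional on a Kurihara CLAIM — the non-vanishing mod `p` of a finite sum of
plus modular symbols `[a/n]⁺_f` of the curve's newform, as OUTPUT BY PARI `msfromell`
(`KuriharaCertificates.Record.Claim`): a trusted external computation. The kit makes such a claim a KERNEL
THEOREM: the plus M-symbol eigenvector of the newform on `ℙ¹(ℤ/N)` is certified by `decide` against the
tree's PROVED M-symbol theory (`ModularSymbolsManin`, `Gamma0CosetP1`, `HeckeOnManinSymbols`,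
Popa–Zagier's `coeffN`), uniqueness by a rank certificate mod `q`, the values `[a/n]⁺` by Manin-trick
chains, the normalisation by `re Λ_f = ℤ·Ω⁺_f/2` (`plusPeriod`) and the tree's integrality theorem.

THIS FILE (no computation yet; `N` prime throughout):
* `e N i` (`i : ℕ`) — the coset of `SL₂(ℤ)/Γ₀(N)` with first column `(1 : i)` (`i < N`) or `(0 : 1)`
  (`i ≥ N`); `idxZ`, `colZ`, `actIdx N B i` — the index of `[B̄ · col i]`; `mk_eq_e` (every coset is an
  `e N i`), `actP_e_adjugate` (`actP (e i) (adj B) = e (actIdx B i)`), `inv_smul_e`.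
* `Ψ f i = re ([e N i]_f)` and its relations: `rel_two` (`Ψ i + Ψ (s i) = 0`), `rel_three`, `rel_iota`
  (`Ψ (ι i) = Ψ i` for real Fourier coefficients, via `{∞,-r} = conj {∞,r}`), `rel_hecke` (for
  `T_n f = a f`, `(n, N) = 1`: `∑_{M ∈ H} c₁₂(M) Ψ(actIdx M i) = 24 a Ψ i` over any finite `H ⊇ supp ξ_n`
  of determinant-`n` matrices, `ξ_n = coeffN n` the Popa–Zagier element, `c₁₂ = 12 ξ_n`).

References: [CremonaAlgorithms1997] §2.2 (Prop. 2.2.2), §2.4; [PopaZagier2017] Thm. 1, §4 (13), §5;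
Manin 1972 §1.5–1.7.
-/

set_option linter.dupNamespace false

noncomputable section

open scoped MatrixGroups ModularForm
open CongruenceSubgroup ModularGroup Matrix
open Literature.NumberTheory.EllipticCurves Literature.NumberTheory.EllipticCurves.ModularForms
open Literature.NumberTheory.Automorphic.PopaZagier (coeffN coeff coeff12 coeff12M coeffN_det
  finite_support_coeffN orbT_zeta0_coeffN_eq coeff12_bounds)

namespace Summit.BirchSwinnertonDyer.BirchSwinnertonDyer.Theorems.KolyvaginDepthDoor.MSymbolCert

/-! ## §1 `ℙ¹(ℤ/N)` for prime `N`, indexed by `{0, …, N}` -/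

section Defs

variable (N : ℕ)

/-- The lower unipotent matrix `(1 0; i 1) ∈ SL₂(ℤ)` (first column `(1, i)`). [folklore] -/
def lowerUni (i : ℤ) : SL(2, ℤ) := ⟨!![1, 0; i, 1], by simp [Matrix.det_fin_two_of]⟩

/-- `e N i`: the coset `gΓ₀(N)` with first column `(1 : i)` for `i < N` (representative `(1 0; i 1)`), and
the coset of `S` (first column `(0 : 1)`) for `i ≥ N`. For prime `N` these `N + 1` cosets exhaust
`SL₂(ℤ)/Γ₀(N) ≅ ℙ¹(ℤ/N)` (`mk_eq_e`). [cite: CremonaAlgorithms1997, §2.2 Prop. 2.2.2] -/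
def e (i : ℕ) : Gamma0Coset N :=
  if i < N then ((lowerUni i : SL(2, ℤ)) : Gamma0Coset N) else ((S : SL(2, ℤ)) : Gamma0Coset N)

/-- The unimodular column `(1, i)` (`i < N`) or `(0, 1)` (`i ≥ N`) attached to the index `i`. [folklore] -/
def colZ (i : ℕ) : Fin 2 → ZMod N := if i < N then ![1, (i : ZMod N)] else ![0, 1]

/-- `colZ N i` is unimodular. [folklore] -/
theorem isCoprime_colZ (i : ℕ) : IsCoprime (colZ N i 0) (colZ N i 1) := by
  unfold colZ
  split_ifs
  · simpa using isCoprime_one_left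
  · simpa using isCoprime_one_right

/-- `colZ N i` as a unimodular column. [folklore] -/
def colU (i : ℕ) : UniCol N := ⟨colZ N i, isCoprime_colZ N i⟩

/-- The index in `{0, …, N}` of the class of the column `(a, c)` modulo `N` (prime): `N` if `a = 0`, else the
residue of `c/a`. [cite: CremonaAlgorithms1997, §2.2] -/
def idxZ (a c : ZMod N) : ℕ := if a = 0 then N else (c * a⁻¹).val

/-- The index of `[B̄ · colZ i]`: the action of an integer matrix `B` (determinant prime to `N`) on indices.
[cite: PopaZagier2017, §5] -/
def actIdx (B : Matrix (Fin 2) (Fin 2) ℤ) (i : ℕ) : ℕ :=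
  idxZ N ((redMat N B *ᵥ colZ N i) 0) ((redMat N B *ᵥ colZ N i) 1)

/-- The index of the conjugate coset `ι(e i)` (first column `(a, -c)`). [cite: CremonaAlgorithms1997, §2.1.4] -/
def iotaIdx (i : ℕ) : ℕ := idxZ N (colZ N i 0) (-(colZ N i 1))

/-- The index of `S⁻¹ • e i` (two-term partner): `[adj S̄ · col i] = [(c, -a)]`. [cite: CremonaAlgorithms1997, §2.2 (2.2.5)] -/
def sIdx (i : ℕ) : ℕ := actIdx N (S : Matrix (Fin 2) (Fin 2) ℤ).adjugate i

/-- The index of `(TS)⁻¹ • e i` (three-term partner): `[(c, c - a)]`. [cite: CremonaAlgorithms1997, §2.2 (2.2.6)] -/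
def uIdx (i : ℕ) : ℕ := actIdx N ((T : Matrix (Fin 2) (Fin 2) ℤ) * (S : Matrix (Fin 2) (Fin 2) ℤ)).adjugate i

/-- Conjugation of `g ∈ SL₂(ℤ)` by `diag(-1, 1)`: `(a b; c d) ↦ (a -b; -c d)`. [cite: CremonaAlgorithms1997, §2.1.4] -/
def conjNeg (g : SL(2, ℤ)) : SL(2, ℤ) :=
  ⟨!![g 0 0, -g 0 1; -g 1 0, g 1 1], by
    have := g.det_coe
    rw [Matrix.det_fin_two] at this
    rw [Matrix.det_fin_two_of]
    linarith⟩

end Defs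

section Prime

variable (N : ℕ) [Fact N.Prime]

/-- A prime level is non-zero (instance used by the coset and `ℙ¹` API of the tree). [folklore] -/
instance neZero_of_fact_prime : NeZero N := ⟨(Fact.out : N.Prime).ne_zero⟩

/-- `idxZ` takes values `≤ N`. [folklore] -/
theorem idxZ_le (a c : ZMod N) : idxZ N a c ≤ N := by
  unfold idxZ
  split_ifs
  · exact le_rfl
  · exact (ZMod.val_lt _).le

/-- Under `SL₂(ℤ)/Γ₀(N) ≅ ℙ¹(ℤ/N)`, `e N i ↦ [colZ N i]`. [cite: CremonaAlgorithms1997, §2.2 Prop. 2.2.2] -/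
theorem cosetEquivP1_e (i : ℕ) : cosetEquivP1 N (e N i) = P1.mk (colU N i) := by
  unfold e colU
  split_ifs with h
  · rw [cosetEquivP1_mk, colP]
    congr 1
    apply Subtype.ext
    ext j
    fin_cases j <;> simp [firstCol, lowerUni, colZ, h]
  · rw [cosetEquivP1_mk, colP]
    congr 1
    apply Subtype.ext
    ext j
    fin_cases j <;> simp [firstCol, ModularGroup.S, colZ, h]

/-- **Every unimodular column is the column of some index**: `[v] = [colZ (idxZ v₀ v₁)]` in `ℙ¹(ℤ/N)`,
`N` prime. [cite: CremonaAlgorithms1997, §2.2 Prop. 2.2.2] -/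
theorem mk_eq_mk_colU (v : UniCol N) : P1.mk v = P1.mk (colU N (idxZ N (v.1 0) (v.1 1))) := by
  rw [P1.mk_eq_mk_iff]
  change v.1 0 * colZ N _ 1 = v.1 1 * colZ N _ 0
  unfold idxZ colZ
  by_cases ha : v.1 0 = 0
  · simp [ha]
  · have hlt : (v.1 1 * (v.1 0)⁻¹).val < N := ZMod.val_lt _
    simp only [ha, ↓reduceIte, hlt, Matrix.cons_val_zero, Matrix.cons_val_one, Matrix.cons_val_fin_one,
      ZMod.natCast_val, ZMod.cast_id', id_eq, mul_one]
    rw [mul_comm, mul_assoc, inv_mul_cancel₀ ha, mul_one]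

/-- **Every coset is an `e N i`**: `gΓ₀(N) = e N (idxZ ḡ₀₀ ḡ₁₀)`. [cite: CremonaAlgorithms1997, §2.2 Prop. 2.2.2] -/
theorem mk_eq_e (g : SL(2, ℤ)) :
    ((g : Gamma0Coset N)) = e N (idxZ N ((g 0 0 : ℤ) : ZMod N) ((g 1 0 : ℤ) : ZMod N)) := by
  apply (cosetEquivP1 N).injective
  rw [cosetEquivP1_mk, cosetEquivP1_e, colP, mk_eq_mk_colU]
  rfl

/-- `actIdx` takes values `≤ N`. [folklore] -/
theorem actIdx_le (B : Matrix (Fin 2) (Fin 2) ℤ) (i : ℕ) : actIdx N B i ≤ N := idxZ_le N _ _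

/-- **`actP (e i) (adj B) = e (actIdx B i)`** for `det B` prime to `N` (the tree's right action of `adj B`
on cosets is `[v] ↦ [B̄ v]` on first columns, `cosetEquivP1_actP_adjugate`). [cite: PopaZagier2017, §5] -/
theorem actP_e_adjugate {B : Matrix (Fin 2) (Fin 2) ℤ} (hB : IsUnit ((B.det : ℤ) : ZMod N)) (i : ℕ) :
    actP N (e N i) B.adjugate = e N (actIdx N B i) := by
  have hB' : IsUnit (redMat N B).det := (isUnit_det_redMat_iff N B).mpr hB
  apply (cosetEquivP1 N).injective
  rw [cosetEquivP1_actP_adjugate, cosetEquivP1_e, cosetEquivP1_e, smulP1_mk N hB', actIdx]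
  exact mk_eq_mk_colU N _

/-- **`γ⁻¹ • e i = e (actIdx (adj γ) i)`** for `γ ∈ SL₂(ℤ)` (`actP_coe`: `actP q γ = γ⁻¹ • q`, and
`adj (adj γ) = γ`). [cite: PopaZagier2017, §5] -/
theorem inv_smul_e (γ : SL(2, ℤ)) (i : ℕ) :
    γ⁻¹ • e N i = e N (actIdx N (γ : Matrix (Fin 2) (Fin 2) ℤ).adjugate i) := by
  have hadj : ((γ : Matrix (Fin 2) (Fin 2) ℤ).adjugate).adjugate = (γ : Matrix (Fin 2) (Fin 2) ℤ) := by
    rw [Matrix.adjugate_adjugate _ (by simp)]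
    simp
  have hdet : IsUnit ((((γ : Matrix (Fin 2) (Fin 2) ℤ).adjugate).det : ℤ) : ZMod N) := by
    rw [Matrix.det_adjugate, γ.det_coe]; simp
  rw [← actP_coe, ← hadj, actP_e_adjugate N hdet, hadj]

/-! ## §2 The real parts of the M-symbols and their relations in index form -/

variable {N}
variable (f : CuspForm (Gamma0 N) 2)

/-- `Ψ f i = re [e N i]_f`, the real part of the M-symbol `{g⁻¹0, g⁻¹∞}_f` of the coset `e N i = gΓ₀(N)`.
[cite: CremonaAlgorithms1997, §2.2] -/
def Ψ (i : ℕ) : ℝ := ((msymbol N (e N i)) f).re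

/-- **Two-term relation**: `Ψ i + Ψ (sIdx i) = 0` (`[q] + [S⁻¹q] = 0`, `msymbol_add_msymbol_S_inv_smul`).
[cite: CremonaAlgorithms1997, §2.2 (2.2.5)] -/
theorem rel_two (i : ℕ) : Ψ f i + Ψ f (sIdx N i) = 0 := by
  have h := congrArg (fun φ : Module.Dual ℂ (CuspForm (Gamma0 N) 2) => (φ f).re)
    (msymbol_add_msymbol_S_inv_smul (N := N) (e N i))
  simp only [LinearMap.add_apply, Complex.add_re, LinearMap.zero_apply, Complex.zero_re] at h
  rw [inv_smul_e] at h
  exact h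

/-- **Three-term relation**: `Ψ i + Ψ (uIdx i) + Ψ (uIdx (uIdx i)) = 0` (`[q] + [(TS)⁻¹q] + [(TS)⁻²q] = 0`,
`msymbol_three_term`). [cite: CremonaAlgorithms1997, §2.2 (2.2.6)] -/
theorem rel_three (i : ℕ) : Ψ f i + Ψ f (uIdx N i) + Ψ f (uIdx N (uIdx N i)) = 0 := by
  have h := congrArg (fun φ : Module.Dual ℂ (CuspForm (Gamma0 N) 2) => (φ f).re)
    (msymbol_three_term (N := N) (e N i))
  simp only [LinearMap.add_apply, Complex.add_re, LinearMap.zero_apply, Complex.zero_re] at h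
  rw [pow_two, mul_smul, inv_smul_e, Matrix.SpecialLinearGroup.coe_mul, inv_smul_e,
    Matrix.SpecialLinearGroup.coe_mul] at h
  exact h

/-! ### Conjugation: `re [ιq] = re [q]` -/

/-- Entries of `conjNeg`. [folklore] -/
@[simp] theorem conjNeg_apply_00 (g : SL(2, ℤ)) : (conjNeg g) 0 0 = g 0 0 := rfl
/-- Entries of `conjNeg`. [folklore] -/
@[simp] theorem conjNeg_apply_01 (g : SL(2, ℤ)) : (conjNeg g) 0 1 = -g 0 1 := rfl
/-- Entries of `conjNeg`. [folklore] -/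
@[simp] theorem conjNeg_apply_10 (g : SL(2, ℤ)) : (conjNeg g) 1 0 = -g 1 0 := rfl
/-- Entries of `conjNeg`. [folklore] -/
@[simp] theorem conjNeg_apply_11 (g : SL(2, ℤ)) : (conjNeg g) 1 1 = g 1 1 := rfl

/-- `conjNeg` commutes with inversion. [folklore] -/
theorem conjNeg_inv (g : SL(2, ℤ)) : conjNeg g⁻¹ = (conjNeg g)⁻¹ := by
  ext i j
  fin_cases i <;> fin_cases j <;>
    simp [conjNeg, Matrix.SpecialLinearGroup.coe_inv, Matrix.adjugate_fin_two]

/-- `{∞, (conjNeg k)∞} = conj {∞, k∞}` for `f` with real Fourier coefficients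
(`{∞, -r} = conj {∞, r}`, `modularSymbol_neg_eq_conj_holds`). [cite: CremonaAlgorithms1997, §2.1.4] -/
theorem inftySymbol_conjNeg (hreal : ∀ n, (cuspCoeff f n).im = 0) (k : SL(2, ℤ)) :
    inftySymbol f (conjNeg k) = starRingEnd ℂ (inftySymbol f k) := by
  unfold inftySymbol
  simp only [conjNeg_apply_10, conjNeg_apply_00, neg_eq_zero]
  split_ifs with h
  · simp
  · rw [← modularSymbol_neg_eq_conj_holds f hreal]
    congr 1
    push_cast
    rw [div_neg]

/-- `[conjNeg k]_f = conj [k]_f` for `f` with real Fourier coefficients. [cite: CremonaAlgorithms1997, §2.1.4] -/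
theorem msymbolSL_conjNeg (hreal : ∀ n, (cuspCoeff f n).im = 0) (k : SL(2, ℤ)) :
    msymbolSL f (conjNeg k) = starRingEnd ℂ (msymbolSL f k) := by
  unfold msymbolSL
  have h2 : inftySymbol f (conjNeg k * S) = inftySymbol f (conjNeg (k * S)) := by
    refine inftySymbol_eq_of_apply_eq f (-1) (Or.inr rfl) ?_ ?_ <;>
      simp [conjNeg, ModularGroup.S, Matrix.mul_apply, Fin.sum_univ_two]
  rw [map_sub, h2, inftySymbol_conjNeg f hreal, inftySymbol_conjNeg f hreal]

/-- **`[ (conjNeg g)Γ₀(N) ]_f = conj [ gΓ₀(N) ]_f`** for real Fourier coefficients. [cite: CremonaAlgorithms1997, §2.1.4] -/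
theorem msymbol_mk_conjNeg (hreal : ∀ n, (cuspCoeff f n).im = 0) (g : SL(2, ℤ)) :
    (msymbol N ((conjNeg g : SL(2, ℤ)) : Gamma0Coset N)) f = starRingEnd ℂ ((msymbol N (g : Gamma0Coset N)) f) := by
  rw [msymbol_mk, msymbol_mk, msymbolFunctional_apply, msymbolFunctional_apply, ← conjNeg_inv,
    msymbolSL_conjNeg f hreal]

/-- `e (iotaIdx i)` is the conjugate coset of `e i`. [folklore] -/
theorem e_iotaIdx (i : ℕ) :
    e N (iotaIdx N i) = ((conjNeg (if i < N then lowerUni i else S) : SL(2, ℤ)) : Gamma0Coset N) := by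
  rw [mk_eq_e, iotaIdx]
  unfold colZ
  split_ifs with h
  · simp [lowerUni]
  · simp [ModularGroup.S]

omit [Fact N.Prime] in
/-- `e i` as the coset of its standard representative. [folklore] -/
theorem e_eq_mk (i : ℕ) : e N i = (((if i < N then lowerUni i else S : SL(2, ℤ))) : Gamma0Coset N) := by
  unfold e
  split_ifs <;> rfl

/-- **Conjugation relation**: `Ψ (iotaIdx i) = Ψ i` for `f` with real Fourier coefficients. [cite: CremonaAlgorithms1997, §2.1.4] -/
theorem rel_iota (hreal : ∀ n, (cuspCoeff f n).im = 0) (i : ℕ) : Ψ f (iotaIdx N i) = Ψ f i := by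
  unfold Ψ
  rw [e_iotaIdx, msymbol_mk_conjNeg f hreal, ← e_eq_mk, Complex.conj_re]

/-! ### The Hecke relation (Popa–Zagier element, `(n, N) = 1`) -/

/-- **Hecke relation in index form.** If `T_n f = a • f` (`n ≥ 1`, `(n, N) = 1`) and `H` is a finite set of
integer matrices of determinant `n` containing the support of the Popa–Zagier element `ξ_n = coeffN n`,
then `∑_{M ∈ H} ξ_n(M) · Ψ(actIdx M i) = 2 a Ψ i` (`finsum_smul_msymbol_eq`: `∑ ξ_n(M) [q · adj M] = 2 [q]_{T_n f}`).
[cite: PopaZagier2017, Thm. 1, §5] -/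
theorem rel_hecke {n : ℕ} (hn : 0 < n) (hnN : n.Coprime N) {a : ℝ}
    (hT : heckeTnGamma0 N 2 n f = (a : ℂ) • f)
    (H : Finset (Matrix (Fin 2) (Fin 2) ℤ)) (hH : Function.support (coeffN n) ⊆ ↑H)
    (hdet : ∀ M ∈ H, M.det = n) (i : ℕ) :
    ∑ M ∈ H, (coeffN n M : ℝ) * Ψ f (actIdx N M i) = 2 * a * Ψ f i := by
  have hn' : (0 : ℤ) < n := by exact_mod_cast hn
  have key := finsum_smul_msymbol_eq f hn hnN (finite_support_coeffN n) (fun M hM => coeffN_det hM)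
    (fun M hM => orbT_zeta0_coeffN_eq hn' hM) (e N i)
  rw [finsum_eq_sum_of_support_subset _ (s := H) ?_] at key
  swap
  · intro M hM
    exact hH (Function.support_smul_subset_left _ _ hM)
  rw [hT, map_smul] at key
  have key' := congrArg Complex.re key
  rw [Complex.re_sum] at key'
  have hunit : IsUnit (((n : ℤ) : ℤ) : ZMod N) := by
    rw [Int.cast_natCast]; exact (ZMod.isUnit_iff_coprime n N).mpr hnN
  have hterm : ∀ M ∈ H, (coeffN n M • (msymbol N (actP N (e N i) M.adjugate)) f).re =
      (coeffN n M : ℝ) * Ψ f (actIdx N M i) := by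
    intro M hM
    have hM : IsUnit ((M.det : ℤ) : ZMod N) := by rw [hdet M hM]; exact hunit
    rw [actP_e_adjugate N hM, Complex.smul_re, Rat.smul_def, Ψ]
  rw [Finset.sum_congr rfl hterm] at key'
  rw [key', Complex.smul_re, smul_eq_mul, Complex.re_ofReal_mul, Ψ, Rat.smul_def]
  push_cast
  ring

end Prime

end Summit.BirchSwinnertonDyer.BirchSwinnertonDyer.Theorems.KolyvaginDepthDoor.MSymbolCert

end
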